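import Mathlib.FieldTheory.IsAlgClosed.Basic
import Literature.AnabelianGeometry.AbsoluteAnabelian.AbsTopIII.LinearSystems
import Literature.NumberTheory.DiophantineGeometry.FunctionFieldDivisorsResidueMap
import Literature.NumberTheory.DiophantineGeometry.FunctionFieldGenusProofs
import HarnessLib

/-!
# [AbsTopIII] Prop. 1.2 (ii), (iii): the interpolants `f_{λ,i}` — proofs (`LinearSystemsProp12Proofs`)

Mochizuki, *Topics in Absolute Anabelian Geometry III*, §1, Proposition 1.2 "Additive Structure
via Linear Systems", p. 29–30 of the author's manuscript (lit key `paper:url-5493eb38cbb7`; the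
journal pagination is not held).  This is the PROOF-ONLY companion of
`AbsTopIII/LinearSystems.lean` (statements by abc-iut-L4-t1, p403944; companion split per
abc-iut-L4-lead ruling ξ: this file = Prop. 1.2 (ii)(iii), `LinearSystemsProp11Proofs` =
Prop. 1.1 (ii) + Prop. 1.2 (i), `LinearSystemsProp13Proofs` = Prop. 1.3 by abc-iut-L4-t7): it
DISCHARGES the named facts

* `Prop_1_2_iii` — the sum `f_{λ,1} + f_{μ,2}` is the unique `g ∈ Γ^×(D)` with
  `g(y₁) = f_{λ,1}(y₁)`, `g(y₂) = f_{μ,2}(y₂)`, and `(f_{λ,1} + f_{μ,2})(x) = λ + μ`;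
* `Prop_1_2_ii` — existence and uniqueness of the interpolants `f_{λ,i} ∈ Γ^×(D)` with
  `f_{λ,i}(x) = λ`, `f_{λ,i}(y_i) ≠ 0`, `f_{λ,i}(y_{3-i}) = 0`,

for the function field `K/k` of a proper curve over an algebraically closed field `k`, exactly as
typed there (the hypothesis `2 ≤ genus k K` carried by the named facts is not used by these two
items; the printed proof, p. 30, is "assertions (ii), (iii) follow immediately from assertion
(i)").

## Proof sketch (ours; the text gives none beyond the sentence quoted)

Everything is ultrametric valuation calculus at the three places `x, y₁, y₂ ∉ Supp(D)` over the
tree's function-field library (`Literature.NumberTheory.DiophantineGeometry.FunctionField*`):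

* "`f(y) = 0`" for `f ∈ L(D)` with `D(y) = 0` means `f ∈ L(D - y)`
  (`mem_riemannRochSpace_sub_pointDivisor`, discreteness of the place, Stichtenoth Thm. 1.1.6);
* `ℓ(E) = 0` means `L(E) = 0` since `L(E)` is finite-dimensional
  (`AlgFunctionField.finiteDimensional_riemannRochSpace_holds`, Stichtenoth Prop. 1.4.9);
* hence an element of `L(D)` vanishing at two of the three points is `0`
  (`ℓ(D - e₁ - e₂) = 0`), which gives every uniqueness clause;
* for `k` algebraically closed every place is rational: the residue field `k(v)` is finite over
  `k` (Stichtenoth Prop. 1.1.15, `finiteDimensional_residueField_holds`), so `k → k(v)` is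
  bijective (`IsAlgClosed.algebraMap_bijective_of_isIntegral`); thus every `f ∈ 𝒪_v` HAS a
  value `f(v) ∈ k` (`exists_hasValue`) and `deg v = 1` (`placeDegree_eq_one_of_isAlgClosed`);
* existence of `f_{λ,i}`: `ℓ(D - y_{3-i}) ≥ ℓ(D) - deg y_{3-i} = 1` (Stichtenoth Lemma 1.4.8,
  `AlgFunctionField.ell_add_single_le`), so some `f₀ ≠ 0` lies in `L(D - y_{3-i})`; it does not
  vanish at `x` or `y_i` (else it would be `0` by the previous bullet), and `f_{λ,i}` is the
  rescaling `(λ / f₀(x)) · f₀`.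

No new definitions; nothing here takes a side on [IUTchIII] Cor. 3.12 — these are kernel checks of
classical statements about divisors on curves.
-/

noncomputable section

open scoped Classical

namespace Literature.AnabelianGeometry.AbsoluteAnabelian.AbsTopIII

open Literature.NumberTheory.DiophantineGeometry
open Literature.NumberTheory.DiophantineGeometry.AlgFunctionField

universe u v

variable {k : Type u} {K : Type v} [Field k] [Field K] [Algebra k K]

/-! ### Constants at a place -/

/-- Constants lie in every valuation ring: `v(c) ≤ 1` for `c ∈ k` (Stichtenoth I.1.5).
[cite: Stichtenoth2009, Prop. 1.1.5] -/
private theorem valuation_algebraMap_le_one (v : PlaceOver k K) (c : k) :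
    v.valuation (algebraMap k K c) ≤ 1 :=
  v.toValuationSubring.valuation_le_one ⟨_, v.algebraMap_mem c⟩

/-- Nonzero constants are units at every place: `v(c) = 1` for `c ∈ k^×` (Stichtenoth I.1.5).
[cite: Stichtenoth2009, Prop. 1.1.5] -/
private theorem valuation_algebraMap_eq_one (v : PlaceOver k K) {c : k} (hc : c ≠ 0) :
    v.valuation (algebraMap k K c) = 1 := by
  refine le_antisymm (valuation_algebraMap_le_one v c) ?_
  have h := valuation_algebraMap_le_one v c⁻¹
  have h0 : 0 < v.valuation (algebraMap k K c) :=
    (Valuation.pos_iff _).2 ((map_ne_zero (algebraMap k K)).2 hc)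
  rwa [map_inv₀, map_inv₀, inv_le_one₀ h0] at h

/-! ### The predicate `f(x) = λ` (`HasValue`) -/

/-- `f(v) = 0` means `v(f) < 1`, i.e. `f ∈ 𝔪_v`. [cite: MochizukiAbsTopIII2015, Prop 1.2 (ii) p.29] -/
private theorem hasValue_zero_iff (v : PlaceOver k K) (f : K) : HasValue v f 0 ↔ v.valuation f < 1 := by
  simp [HasValue]

/-- A function with a value at `v` is regular at `v`: `f(v) = λ ⇒ v(f) ≤ 1`.
[cite: MochizukiAbsTopIII2015, Prop 1.2 (ii) p.29] -/
private theorem HasValue.valuation_le_one {v : PlaceOver k K} {f : K} {a : k} (h : HasValue v f a) :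
    v.valuation f ≤ 1 := by
  have e : f = (f - algebraMap k K a) + algebraMap k K a := by ring
  rw [e]
  exact (Valuation.map_add _ _ _).trans (max_le h.le (valuation_algebraMap_le_one v a))

/-- Values add: `f(v) = λ`, `g(v) = μ ⇒ (f + g)(v) = λ + μ` (ultrametric inequality).
[cite: MochizukiAbsTopIII2015, Prop 1.2 (iii) p.30] -/
private theorem HasValue.add {v : PlaceOver k K} {f g : K} {a b : k} (hf : HasValue v f a)
    (hg : HasValue v g b) : HasValue v (f + g) (a + b) := by
  unfold HasValue at hf hg ⊢
  have e : f + g - algebraMap k K (a + b) = (f - algebraMap k K a) + (g - algebraMap k K b) := by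
    rw [map_add]; ring
  rw [e]
  exact Valuation.map_add_lt _ hf hg

/-- Values scale: `f(v) = λ ⇒ (c • f)(v) = c λ` for a constant `c ∈ k`.
[cite: MochizukiAbsTopIII2015, Prop 1.2 (ii) p.29] -/
private theorem HasValue.smul {v : PlaceOver k K} {f : K} {a : k} (hf : HasValue v f a) (c : k) :
    HasValue v (c • f) (c * a) := by
  unfold HasValue at hf ⊢
  have e : c • f - algebraMap k K (c * a) = algebraMap k K c * (f - algebraMap k K a) := by
    rw [Algebra.smul_def, map_mul]; ring
  rw [e, Valuation.map_mul]
  exact (mul_le_of_le_one_left' (valuation_algebraMap_le_one v c)).trans_lt hf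

/-- Two functions with the same value at `v` differ by an element of `𝔪_v`:
`f(v) = λ = g(v) ⇒ v(f - g) < 1`. [cite: MochizukiAbsTopIII2015, Prop 1.2 (ii) p.29] -/
private theorem HasValue.valuation_sub_lt_one {v : PlaceOver k K} {f g : K} {a : k} (hf : HasValue v f a)
    (hg : HasValue v g a) : v.valuation (f - g) < 1 := by
  unfold HasValue at hf hg
  have e : f - g = (f - algebraMap k K a) - (g - algebraMap k K a) := by ring
  rw [e]
  exact Valuation.map_sub_lt _ hf hg

/-- For `k` algebraically closed every place of the function field `K/k` is rational: the
structure map `k → k(v)` to the residue field is bijective (`k(v)` is a finite, hence algebraic,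
extension of `k` — Stichtenoth Prop. 1.1.15 — and `k` is algebraically closed).
[cite: Stichtenoth2009, Prop. 1.1.15] -/
private theorem algebraMap_residueField_bijective_of_isAlgClosed [IsAlgClosed k] [IsAlgFunctionField k K]
    (v : PlaceOver k K) : Function.Bijective (algebraMap k v.residueField) := by
  haveI : FiniteDimensional k v.residueField :=
    PlaceOver.finiteDimensional_residueField_holds (K := k) (F := K) v
  haveI : Algebra.IsIntegral k v.residueField := Algebra.IsIntegral.of_finite k _
  exact IsAlgClosed.algebraMap_bijective_of_isIntegral (k := k) (K := v.residueField)

/-- For `k` algebraically closed every place of `K/k` has degree one.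
[cite: Stichtenoth2009, Def. 1.1.14 and Prop. 1.1.15] -/
private theorem placeDegree_eq_one_of_isAlgClosed [IsAlgClosed k] [IsAlgFunctionField k K]
    (v : PlaceOver k K) : v.degree = 1 := by
  have hb := algebraMap_residueField_bijective_of_isAlgClosed (k := k) (K := K) v
  have e := (LinearEquiv.ofBijective (Algebra.linearMap k v.residueField) hb).finrank_eq
  rw [Module.finrank_self] at e
  exact e.symm

/-- Over an algebraically closed constant field every function regular at `v` HAS a value in `k`:
`v(f) ≤ 1 ⇒ ∃ λ ∈ k, f(v) = λ` ([AbsTopIII] p. 29: "`f_{λ,i}(x) = λ`" presupposes exactly this;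
Stichtenoth Prop. 1.1.15 + `k = k̄`). [cite: MochizukiAbsTopIII2015, Prop 1.2 (ii) p.29] -/
private theorem exists_hasValue [IsAlgClosed k] [IsAlgFunctionField k K] (v : PlaceOver k K) {f : K}
    (hf : v.valuation f ≤ 1) : ∃ a : k, HasValue v f a := by
  have hfO : f ∈ v.toValuationSubring := (v.toValuationSubring.valuation_le_one_iff f).1 hf
  obtain ⟨a, ha⟩ := (algebraMap_residueField_bijective_of_isAlgClosed (k := k) (K := K) v).2
    (IsLocalRing.residue v.toValuationSubring ⟨f, hfO⟩)
  refine ⟨a, ?_⟩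
  have hmem : (⟨f, hfO⟩ - algebraMap k v.toValuationSubring a : v.toValuationSubring) ∈
      IsLocalRing.maximalIdeal v.toValuationSubring := by
    rw [← IsLocalRing.residue_eq_zero_iff, map_sub, ← ha, PlaceOver.algebraMap_residueField_apply,
      sub_self]
  have hlt := (v.toValuationSubring.valuation_lt_one_iff _).1 hmem
  simpa [HasValue] using hlt

/-! ### Vanishing at a point outside the support lowers the divisor -/

/-- If `f ∈ L(D)`, `P ∉ Supp(D)` and `f(P) = 0` (i.e. `v_P(f) < 1`), then `f ∈ L(D - P)`
(discreteness: `v_P(f) < 1 ⇒ v_P(f) ≤ v_P(π_P)`, Stichtenoth Thm. 1.1.6 (b)).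
[cite: Stichtenoth2009, Thm. 1.1.6(b)] -/
private theorem mem_riemannRochSpace_sub_pointDivisor {D : Divisor k K} {P : PlaceOver k K} {f : K}
    (hf : f ∈ riemannRochSpace D) (hP : D P = 0) (hlt : P.valuation f < 1) :
    f ∈ riemannRochSpace (D - pointDivisor P) := by
  intro w
  by_cases hw : w = P
  · subst hw
    have e : -((D - pointDivisor w) w) = 1 := by simp [pointDivisor, hP]
    rw [e, zpow_one]
    exact (PlaceOver.valuation_lt_one_iff_le w f).1 hlt
  · have e : (D - pointDivisor P) w = D w := by
      simp [pointDivisor, Ne.symm hw]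
    rw [e]
    exact hf w

/-- `f ∈ L(D)` and `P ∉ Supp(D)` give `v_P(f) ≤ 1` (`f` is regular at `P`).
[cite: Stichtenoth2009, Def. 1.4.4] -/
private theorem valuation_le_one_of_mem_riemannRochSpace {D : Divisor k K} {P : PlaceOver k K} {f : K}
    (hf : f ∈ riemannRochSpace D) (hP : D P = 0) : P.valuation f ≤ 1 := by
  have h := hf P
  rwa [hP, neg_zero, zpow_zero] at h

/-- `f ∈ L(D - P)` with `P ∉ Supp(D)` vanishes at `P`: `v_P(f) < 1`.
[cite: Stichtenoth2009, Def. 1.4.4] -/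
private theorem valuation_lt_one_of_mem_riemannRochSpace_sub {D : Divisor k K} {P : PlaceOver k K} {f : K}
    (hf : f ∈ riemannRochSpace (D - pointDivisor P)) (hP : D P = 0) : P.valuation f < 1 := by
  have h := hf P
  have e : -((D - pointDivisor P) P) = 1 := by simp [pointDivisor, hP]
  rw [e, zpow_one] at h
  exact h.trans_lt P.valuation_uniformizer_lt_one

/-- In a function field of one variable, `ℓ(E) = 0` forces `L(E) = 0` (`L(E)` is
finite-dimensional, Stichtenoth Prop. 1.4.9). [cite: Stichtenoth2009, Prop. 1.4.9] -/
private theorem riemannRochSpace_eq_bot_of_ell_eq_zero [IsAlgFunctionField k K] {E : Divisor k K}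
    (h : ell E = 0) : riemannRochSpace E = ⊥ := by
  haveI : FiniteDimensional k (riemannRochSpace E) := finiteDimensional_riemannRochSpace_holds E
  exact Submodule.finrank_eq_zero.1 h

/-- The vanishing principle behind Prop. 1.2: if `ℓ(D - e₁ - e₂) = 0` with `e₁ ≠ e₂` outside
`Supp(D)`, an element of `L(D)` vanishing at `e₁` and `e₂` is `0`.
[cite: MochizukiAbsTopIII2015, Prop 1.2 (i) p.29] -/
private theorem eq_zero_of_mem_of_vanish [IsAlgFunctionField k K] {D : Divisor k K}
    {e₁ e₂ : PlaceOver k K} (hne : e₁ ≠ e₂) (h₁ : D e₁ = 0) (h₂ : D e₂ = 0)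
    (hℓ : ell (D - pointDivisor e₁ - pointDivisor e₂) = 0) {f : K} (hf : f ∈ riemannRochSpace D)
    (hv₁ : e₁.valuation f < 1) (hv₂ : e₂.valuation f < 1) : f = 0 := by
  have hm₁ := mem_riemannRochSpace_sub_pointDivisor hf h₁ hv₁
  have h₂' : (D - pointDivisor e₁) e₂ = 0 := by
    simp [pointDivisor, hne, h₂]
  have hm₂ := mem_riemannRochSpace_sub_pointDivisor hm₁ h₂' hv₂
  rw [riemannRochSpace_eq_bot_of_ell_eq_zero hℓ] at hm₂
  exact (Submodule.mem_bot k).1 hm₂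

/-! ### Proposition 1.2 (iii) -/

/-- **DISCHARGE of `Prop_1_2_iii`** ([AbsTopIII] Prop. 1.2 (iii), p. 30): for interpolants
`f_{λ,1}`, `f_{μ,2}` as in (ii), `f_{λ,1} + f_{μ,2}` is a nonzero element of `Γ^×(D)`, it is
the unique `g ∈ Γ^×(D)` with `g(y₁) = f_{λ,1}(y₁)` and `g(y₂) = f_{μ,2}(y₂)`, and
`(f_{λ,1} + f_{μ,2})(x) = λ + μ`.  (The hypotheses `λ, μ ≠ 0`, `λ/μ ≠ -1` and `2 ≤ g` of the
named fact are not needed for the typed conclusion.)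
[cite: MochizukiAbsTopIII2015, Prop 1.2 (iii) p.30] -/
theorem Prop_1_2_iii_holds : Prop_1_2_iii.{u, v} := by
  intro k K _ _ _ _ _ _ D x y₁ y₂ hD a b f₁ f₂ _ _ _ hf₁ hf₂
  have hy₁f₂ : y₁.valuation f₂ < 1 := (hasValue_zero_iff y₁ f₂).1 hf₂.value_y'
  have hy₂f₁ : y₂.valuation f₁ < 1 := (hasValue_zero_iff y₂ f₁).1 hf₁.value_y'
  have hsum : f₁ + f₂ ∈ riemannRochSpace D := add_mem hf₁.mem hf₂.mem
  refine ⟨⟨?_, hsum⟩, ?_, hf₁.value_x.add hf₂.value_x⟩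
  · intro h0
    apply hf₁.value_y
    rw [hasValue_zero_iff, eq_neg_of_add_eq_zero_left h0, Valuation.map_neg]
    exact hy₁f₂
  · intro g _ hg
    constructor
    · rintro ⟨h₁, h₂⟩
      have hv₁ : y₁.valuation (g - (f₁ + f₂)) < 1 := by
        have e : g - (f₁ + f₂) = (g - f₁) - f₂ := by ring
        rw [e]
        exact Valuation.map_sub_lt _ h₁ hy₁f₂
      have hv₂ : y₂.valuation (g - (f₁ + f₂)) < 1 := by
        have e : g - (f₁ + f₂) = (g - f₂) - f₁ := by ring
        rw [e]
        exact Valuation.map_sub_lt _ h₂ hy₂f₁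
      exact sub_eq_zero.1 (eq_zero_of_mem_of_vanish hD.y₁_ne_y₂ hD.apply_y₁ hD.apply_y₂
        hD.ell_sub_y₁_y₂ (sub_mem hg hsum) hv₁ hv₂)
    · rintro rfl
      refine ⟨?_, ?_⟩
      · change y₁.valuation (f₁ + f₂ - f₁) < 1
        rwa [add_sub_cancel_left]
      · change y₂.valuation (f₁ + f₂ - f₂) < 1
        rwa [add_sub_cancel_right]

/-! ### Proposition 1.2 (ii) -/

/-- Existence and uniqueness of the interpolant `f_{λ,i}` at `(x; y, y')` = `(x; y_i, y_{3-i})`: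
from `ℓ(D) = 2`, `ℓ(D - x - y') = ℓ(D - y - y') = 0`, `x, y, y' ∉ Supp(D)` pairwise distinct.
[cite: MochizukiAbsTopIII2015, Prop 1.2 (ii) p.29] -/
private theorem existsUnique_isInterpolant [IsAlgClosed k] [IsAlgFunctionField k K] {D : Divisor k K}
    {x y y' : PlaceOver k K} (hxy' : x ≠ y') (hyy' : y ≠ y') (hDx : D x = 0) (hDy : D y = 0)
    (hDy' : D y' = 0) (hℓ : ell D = 2) (hℓx : ell (D - pointDivisor x - pointDivisor y') = 0)
    (hℓy : ell (D - pointDivisor y - pointDivisor y') = 0) {a : k} (ha : a ≠ 0) :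
    ∃! f : K, IsInterpolant D x y y' a f := by
  -- the subspace `L(D - y')` of functions of `L(D)` vanishing at `y'` is nonzero
  set D' : Divisor k K := D - pointDivisor y' with hD'
  haveI : FiniteDimensional k (riemannRochSpace D') := finiteDimensional_riemannRochSpace_holds D'
  have hDD' : D' + Finsupp.single y' 1 = D := by simp [hD', pointDivisor]
  have hℓD' : 1 ≤ ell D' := by
    have h := ell_add_single_le (K := k) (F := K) D' y'
    rw [hDD', hℓ, placeDegree_eq_one_of_isAlgClosed] at h
    omega
  have hne : riemannRochSpace D' ≠ ⊥ := by
    intro hbot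
    have : ell D' = 0 := Submodule.finrank_eq_zero.2 hbot
    omega
  obtain ⟨f₀, hf₀D', hf₀⟩ := Submodule.exists_mem_ne_zero_of_ne_bot hne
  have hf₀D : f₀ ∈ riemannRochSpace D := by
    rw [← hDD']
    exact y'.riemannRochSpace_le_add_single D' hf₀D'
  have hvy' : y'.valuation f₀ < 1 := valuation_lt_one_of_mem_riemannRochSpace_sub hf₀D' hDy'
  -- `f₀` does not vanish at `x` or at `y`
  have hvx : ¬ x.valuation f₀ < 1 := fun hlt ↦
    hf₀ (eq_zero_of_mem_of_vanish hxy' hDx hDy' hℓx hf₀D hlt hvy')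
  have hvy : ¬ y.valuation f₀ < 1 := fun hlt ↦
    hf₀ (eq_zero_of_mem_of_vanish hyy' hDy hDy' hℓy hf₀D hlt hvy')
  -- rescale so that the value at `x` is `a`
  obtain ⟨c, hc⟩ := exists_hasValue x (valuation_le_one_of_mem_riemannRochSpace hf₀D hDx)
  have hc0 : c ≠ 0 := by
    rintro rfl
    exact hvx ((hasValue_zero_iff x f₀).1 hc)
  have hunit : ∀ w : PlaceOver k K, w.valuation ((a / c) • f₀) = w.valuation f₀ := fun w ↦ by
    rw [Algebra.smul_def, Valuation.map_mul, valuation_algebraMap_eq_one w (div_ne_zero ha hc0),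
      one_mul]
  refine ⟨(a / c) • f₀, ⟨?_, Submodule.smul_mem _ _ hf₀D, ?_, ?_, ?_⟩, ?_⟩
  · exact smul_ne_zero (div_ne_zero ha hc0) hf₀
  · have h := hc.smul (a / c)
    rwa [div_mul_cancel₀ a hc0] at h
  · rw [hasValue_zero_iff, hunit]
    exact hvy
  · rw [hasValue_zero_iff, hunit]
    exact hvy'
  -- uniqueness
  · intro g hg
    set f := (a / c) • f₀ with hf
    have hfI : IsInterpolant D x y y' a f := by
      refine ⟨smul_ne_zero (div_ne_zero ha hc0) hf₀, Submodule.smul_mem _ _ hf₀D, ?_, ?_, ?_⟩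
      · have h := hc.smul (a / c)
        rwa [div_mul_cancel₀ a hc0] at h
      · rw [hasValue_zero_iff, hunit]
        exact hvy
      · rw [hasValue_zero_iff, hunit]
        exact hvy'
    have hvx' : x.valuation (g - f) < 1 := hg.value_x.valuation_sub_lt_one hfI.value_x
    have hvy'' : y'.valuation (g - f) < 1 :=
      Valuation.map_sub_lt _ ((hasValue_zero_iff y' g).1 hg.value_y')
        ((hasValue_zero_iff y' f).1 hfI.value_y')
    exact sub_eq_zero.1
      (eq_zero_of_mem_of_vanish hxy' hDx hDy' hℓx (sub_mem hg.mem hfI.mem) hvx' hvy'')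

/-- **DISCHARGE of `Prop_1_2_ii`** ([AbsTopIII] Prop. 1.2 (ii), p. 29): for `x, y₁, y₂, D` as in
Prop. 1.2 (i) and `λ ∈ k^×` there is, for `i = 1, 2`, a unique `f_{λ,i} ∈ Γ^×(D)` with
`f_{λ,i}(x) = λ`, `f_{λ,i}(y_i) ≠ 0`, `f_{λ,i}(y_{3-i}) = 0`.  (The hypothesis `2 ≤ g` of the
named fact is not needed once the data of (i) are given.)
[cite: MochizukiAbsTopIII2015, Prop 1.2 (ii) p.29] -/
theorem Prop_1_2_ii_holds : Prop_1_2_ii.{u, v} := by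
  intro k K _ _ _ _ _ _ D x y₁ y₂ hD a ha
  refine ⟨existsUnique_isInterpolant hD.x_ne_y₂ hD.y₁_ne_y₂ hD.apply_x hD.apply_y₁ hD.apply_y₂
      hD.ell_eq_two hD.ell_sub_x_y₂ hD.ell_sub_y₁_y₂ ha,
    existsUnique_isInterpolant hD.x_ne_y₁ hD.y₁_ne_y₂.symm hD.apply_x hD.apply_y₂ hD.apply_y₁
      hD.ell_eq_two hD.ell_sub_x_y₁ ?_ ha⟩
  rw [sub_right_comm]
  exact hD.ell_sub_y₁_y₂

end Literature.AnabelianGeometry.AbsoluteAnabelian.AbsTopIII
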